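import Summits.BirchSwinnertonDyer.BirchSwinnertonDyer.Theorems.GoldfeldAllTwistsTwoConverseTwinAdditiveTwoInertThreeTwistSelmer
import HarnessLib

set_option linter.dupNamespace false -- namespace `…BirchSwinnertonDyer.BirchSwinnertonDyer…` is the cell's (D-0017 nested layout)
set_option autoImplicit false

/-!
# Twin″ (item 19140), XIV: a `2`-adic valuation-recursion lemma and the Selmer orders of
# `49a1^{(−2ℓ)}`, `ℓ ≡ 7 (mod 8)` prime INERT in `ℚ(√−7)`

Cell `bsd-goldfeld`, seat `bsd-goldfeld-s1p-c301` (gen 2); `--supports stmt-BirchSwinnertonDyer-19140`. The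
last inert prime class for the `−2ℓ` twists (`ℓ = 31, 47, 79, …`; numerically `S = {1,7}`,
`S' = {1, −7, −ℓ, 7ℓ}`). Here the class `2 ∈ S(−42ℓ, 448ℓ²)` dies ONLY at the prime `2`, and no residue
check modulo a small power of `2` sees it: in the `u`-chart `s² = 224ℓ² − 42ℓ t² + 2t⁴` the value is
`≡ 0 (mod 64)` whenever `4 ∣ t`. The obstruction is a valuation recursion, formalised here:

* `not_sq_eq_twoInertSeven_chartB` — `s² = 224ℓ² − 42ℓt² + 2t⁴` has no solution in `ℤ₂`:
  `s = 2s₁`, `2s₁² = G(t)`; modulo `16`, `t` must be even (`decide`); `t = 2t₁` gives `s₁ = 2s₂`,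
  `2s₂² = 28ℓ² − 21ℓt₁² + 4t₁⁴`, so `t₁` is even (`decide` mod `16`); `t₁ = 2t₂` gives `s₂ = 2s₃`,
  `2s₃² = 7ℓ² − 21ℓt₂² + 16t₂⁴`, impossible mod `16` (`decide`).
* `not_isSoluble_two_twoInertSeven_two` — hence the class `2` (quartic `(−42ℓ, 2, 224ℓ²)`) has no
  `ℚ₂`-point (the other chart is a residue check mod `32`).
* `not_isSoluble_two_twoInertSeven_two'` — the class `2` of `S' = S(84ℓ, −28ℓ²)` (quartic
  `(84ℓ, 2, −14ℓ²)`) has no `ℚ₂`-point (residue check mod `64`).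
* `card_twoIsogenySelmerGroup_twoInertSevenTwist_le` (`#S ≤ 2`) and
  `card_twoIsogenySelmerGroup'_twoInertSevenTwist_le` (`#S' ≤ 4`): as in part X (the classes divisible
  by `ℓ` die at `ℓ`; eight classes of `S'` die at `7`, `ℓ` being a non-residue mod `7`).

Consequences in part XV. HONEST FRAMING: no `BSD(W,2)` is proved; BSD is not proved by any of this.

References: Silverman, *AEC* (2009), X.4.9–X.4.10 [SilvermanAEC2009]; Zywina, arXiv:2502.01957, Lemma 3.1 [Zywina2025].
-/

noncomputable section

open scoped Classical

open WeierstrassCurve Literature.NumberTheory.EllipticCurves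
open Literature.NumberTheory.EllipticCurves.Zywina2025 (exists_padicInt_of_isSoluble
  isSquare_zmod_of_isSoluble_padic)

namespace Summit.BirchSwinnertonDyer.BirchSwinnertonDyer.Theorems.GoldfeldGoodTwists

/-! ## §1. The valuation recursion in `ℤ₂` -/

/-- An element of `ℤ₂` whose residue mod `16` has even representative is divisible by `2`. [folklore] -/
private theorem two_dvd_of_even_val {X : ℤ_[2]} (hX : Even (((PadicInt.toZModPow 4 X).val : ℤ))) :
    (2 : ℤ_[2]) ∣ X := by
  set ψ : ℤ_[2] →+* ZMod (2 ^ 4) := PadicInt.toZModPow 4 with hψdef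
  obtain ⟨x₁, hx₁⟩ := hX
  have h1 : ψ X = ψ (2 * (x₁ : ℤ_[2])) := by
    rw [map_mul, map_intCast, map_ofNat, ← ZMod.natCast_zmod_val (ψ X)]
    have h2 : (((ψ X).val : ℤ) : ZMod (2 ^ 4)) = ((x₁ + x₁ : ℤ) : ZMod (2 ^ 4)) := by rw [hx₁]
    push_cast at h2
    rw [h2]; ring
  have h2 : X - 2 * (x₁ : ℤ_[2]) ∈ RingHom.ker ψ := by
    rw [RingHom.mem_ker, map_sub, h1, sub_self]
  rw [hψdef, PadicInt.ker_toZModPow, Ideal.mem_span_singleton] at h2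
  obtain ⟨c, hc⟩ := h2
  refine ⟨2 ^ 3 * c + x₁, ?_⟩
  have hc' : X = ((2 : ℕ) : ℤ_[2]) ^ 4 * c + 2 * x₁ := by rw [← hc]; ring
  rw [hc']; push_cast; ring

/-- The three finite checks mod `16` of the recursion (`x = ℓ mod 16 ∈ {7, 15}`): the first two force the
variable to be even, the third has no solution. [folklore] -/
private theorem zmod_sixteen_steps : ∀ x T S : ZMod 16, (x = 7 ∨ x = 15) →
    (2 * S ^ 2 = 112 * x ^ 2 - 21 * x * T ^ 2 + T ^ 4 → Even ((T.val : ℤ))) ∧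
    (2 * S ^ 2 = 28 * x ^ 2 - 21 * x * T ^ 2 + 4 * T ^ 4 → Even ((T.val : ℤ))) ∧
    (2 * S ^ 2 ≠ 7 * x ^ 2 - 21 * x * T ^ 2 + 16 * T ^ 4) := by
  decide

/-- `ℓ ≡ 7 (mod 8)` ⇒ `ℓ mod 16 ∈ {7, 15}`. [folklore] -/
private theorem zmod_sixteen_of_mod_eight_seven {l : ℕ} (hl8 : l % 8 = 7) :
    (l : ZMod 16) = 7 ∨ (l : ZMod 16) = 15 := by
  have h : l % 16 = 7 ∨ l % 16 = 15 := by omega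
  rw [← ZMod.natCast_mod l 16]
  rcases h with h | h <;> rw [h] <;> norm_num

/-- **The valuation recursion.** For `ℓ ≡ 7 (mod 8)` the equation `s² = 224ℓ² − 42ℓ t² + 2t⁴` has no
solution in `ℤ₂`. [folklore] -/
theorem not_sq_eq_twoInertSeven_chartB {l : ℕ} (hl8 : l % 8 = 7) {t s : ℤ_[2]}
    (h : s ^ 2 = 224 * (l : ℤ_[2]) ^ 2 - 42 * (l : ℤ_[2]) * t ^ 2 + 2 * t ^ 4) : False := by
  have hP : Prime (2 : ℤ_[2]) := by simpa using (PadicInt.prime_p (p := 2))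
  have h20 : (2 : ℤ_[2]) ≠ 0 := hP.ne_zero
  have hx := zmod_sixteen_of_mod_eight_seven hl8
  set ψ : ℤ_[2] →+* ZMod (2 ^ 4) := PadicInt.toZModPow 4 with hψdef
  have hψl : ψ (l : ℤ_[2]) = (l : ZMod 16) := by rw [map_natCast]
  -- step 1: `s = 2 s₁`, `2 s₁² = G(t)`
  have hs : (2 : ℤ_[2]) ∣ s := hP.dvd_of_dvd_pow (n := 2)
    ⟨112 * (l : ℤ_[2]) ^ 2 - 21 * (l : ℤ_[2]) * t ^ 2 + t ^ 4, by rw [h]; ring⟩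
  obtain ⟨s₁, rfl⟩ := hs
  have h1 : 2 * s₁ ^ 2 = 112 * (l : ℤ_[2]) ^ 2 - 21 * (l : ℤ_[2]) * t ^ 2 + t ^ 4 :=
    mul_left_cancel₀ h20 (by linear_combination h)
  -- `t` is even
  have ht : (2 : ℤ_[2]) ∣ t := by
    apply two_dvd_of_even_val
    have e := congrArg ψ h1
    simp only [map_add, map_sub, map_mul, map_pow, map_ofNat, hψl] at e
    exact (zmod_sixteen_steps (l : ZMod 16) (ψ t) (ψ s₁) hx).1 e
  obtain ⟨t₁, rfl⟩ := ht
  -- step 2: `s₁ = 2 s₂`, `2 s₂² = K(t₁)`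
  have hs₁ : (2 : ℤ_[2]) ∣ s₁ := hP.dvd_of_dvd_pow (n := 2)
    ⟨28 * (l : ℤ_[2]) ^ 2 - 21 * (l : ℤ_[2]) * t₁ ^ 2 + 4 * t₁ ^ 4,
      mul_left_cancel₀ h20 (by linear_combination h1)⟩
  obtain ⟨s₂, rfl⟩ := hs₁
  have h2 : 2 * s₂ ^ 2 = 28 * (l : ℤ_[2]) ^ 2 - 21 * (l : ℤ_[2]) * t₁ ^ 2 + 4 * t₁ ^ 4 :=
    mul_left_cancel₀ h20 (mul_left_cancel₀ h20 (by linear_combination h1))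
  -- `t₁` is even
  have ht₁ : (2 : ℤ_[2]) ∣ t₁ := by
    apply two_dvd_of_even_val
    have e := congrArg ψ h2
    simp only [map_add, map_sub, map_mul, map_pow, map_ofNat, hψl] at e
    exact (zmod_sixteen_steps (l : ZMod 16) (ψ t₁) (ψ s₂) hx).2.1 e
  obtain ⟨t₂, rfl⟩ := ht₁
  -- step 3: `s₂ = 2 s₃`, `2 s₃² = M(t₂)`, impossible mod 16
  have hs₂ : (2 : ℤ_[2]) ∣ s₂ := hP.dvd_of_dvd_pow (n := 2)
    ⟨7 * (l : ℤ_[2]) ^ 2 - 21 * (l : ℤ_[2]) * t₂ ^ 2 + 16 * t₂ ^ 4,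
      mul_left_cancel₀ h20 (by linear_combination h2)⟩
  obtain ⟨s₃, rfl⟩ := hs₂
  have h3 : 2 * s₃ ^ 2 = 7 * (l : ℤ_[2]) ^ 2 - 21 * (l : ℤ_[2]) * t₂ ^ 2 + 16 * t₂ ^ 4 :=
    mul_left_cancel₀ h20 (mul_left_cancel₀ h20 (by linear_combination h2))
  have e := congrArg ψ h3
  simp only [map_add, map_sub, map_mul, map_pow, map_ofNat, hψl] at e
  exact (zmod_sixteen_steps (l : ZMod 16) (ψ t₂) (ψ s₃) hx).2.2 e

/-- Chart `z = 1` of the class `2 ∈ S`, as a residue check mod `32` (`x = ℓ`). [folklore] -/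
private theorem zmod32_chartA : ∀ x : ZMod 32, (x = 7 ∨ x = 15 ∨ x = 23 ∨ x = 31) →
    ∀ T S : ZMod 32, S ^ 2 ≠ 2 - 42 * x * T ^ 2 + 224 * x ^ 2 * T ^ 4 := by
  decide

set_option maxRecDepth 16384 in
/-- Both charts of the class `2 ∈ S' = S(84ℓ, −28ℓ²)`, as residue checks mod `64` (`x = ℓ`; no smaller power
of `2` suffices). [folklore] -/
private theorem zmod64_classTwo' : ∀ x : ZMod 64,
    (x = 7 ∨ x = 15 ∨ x = 23 ∨ x = 31 ∨ x = 39 ∨ x = 47 ∨ x = 55 ∨ x = 63) →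
      ∀ T S : ZMod 64, S ^ 2 ≠ 2 + 84 * x * T ^ 2 - 14 * x ^ 2 * T ^ 4 ∧
        S ^ 2 ≠ -14 * x ^ 2 + 84 * x * T ^ 2 + 2 * T ^ 4 := by
  decide

/-- **The class `2` of `S(−42ℓ, 448ℓ²)` has no `ℚ₂`-point** for `ℓ ≡ 7 (mod 8)` (chart `z = 1`: residues mod
`32`; chart `u = 1`: the valuation recursion). [cite: SilvermanAEC2009, Prop. X.4.9 and Example X.4.10] -/
theorem not_isSoluble_two_twoInertSeven_two {l : ℕ} (hl8 : l % 8 = 7) :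
    ¬ ((twoIsogenyQuartic (-42 * l) 2 (224 * l ^ 2)).map (Int.castRingHom ℚ_[2])).IsSoluble := by
  haveI : Fact (Nat.Prime 2) := ⟨Nat.prime_two⟩
  intro h
  obtain ⟨f, f', hff, t, s, hs⟩ := exists_padicInt_of_isSoluble h
  rcases hff with ⟨rfl, rfl⟩ | ⟨rfl, rfl⟩
  · have hx : (l : ZMod 32) = 7 ∨ (l : ZMod 32) = 15 ∨ (l : ZMod 32) = 23 ∨ (l : ZMod 32) = 31 := by
      have h : l % 32 = 7 ∨ l % 32 = 15 ∨ l % 32 = 23 ∨ l % 32 = 31 := by omega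
      rw [← ZMod.natCast_mod l 32]
      rcases h with h | h | h | h <;> rw [h] <;> norm_num
    have h2 := congrArg (PadicInt.toZModPow 5 : ℤ_[2] →+* ZMod (2 ^ 5)) hs
    simp only [map_pow, map_add, map_mul, map_intCast] at h2
    push_cast at h2
    exact zmod32_chartA (l : ZMod 32) hx (PadicInt.toZModPow 5 t) (PadicInt.toZModPow 5 s)
      (by linear_combination h2)
  · push_cast at hs
    exact not_sq_eq_twoInertSeven_chartB hl8 (t := t) (s := s) (by linear_combination hs)

/-- **The class `2` of `S(84ℓ, −28ℓ²)` has no `ℚ₂`-point** for `ℓ ≡ 7 (mod 8)` (residues mod `64`).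
[cite: SilvermanAEC2009, Prop. X.4.9 and Example X.4.10] -/
theorem not_isSoluble_two_twoInertSeven_two' {l : ℕ} (hl8 : l % 8 = 7) :
    ¬ ((twoIsogenyQuartic (84 * l) 2 (-14 * l ^ 2)).map (Int.castRingHom ℚ_[2])).IsSoluble := by
  haveI : Fact (Nat.Prime 2) := ⟨Nat.prime_two⟩
  intro h
  obtain ⟨f, f', hff, t, s, hs⟩ := exists_padicInt_of_isSoluble h
  have hx : (l : ZMod 64) = 7 ∨ (l : ZMod 64) = 15 ∨ (l : ZMod 64) = 23 ∨ (l : ZMod 64) = 31 ∨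
      (l : ZMod 64) = 39 ∨ (l : ZMod 64) = 47 ∨ (l : ZMod 64) = 55 ∨ (l : ZMod 64) = 63 := by
    have h : l % 64 = 7 ∨ l % 64 = 15 ∨ l % 64 = 23 ∨ l % 64 = 31 ∨ l % 64 = 39 ∨ l % 64 = 47 ∨
        l % 64 = 55 ∨ l % 64 = 63 := by omega
    rw [← ZMod.natCast_mod l 64]
    rcases h with h | h | h | h | h | h | h | h <;> rw [h] <;> norm_num
  have key := zmod64_classTwo' (l : ZMod 64) hx
  have h2 := congrArg (PadicInt.toZModPow 6 : ℤ_[2] →+* ZMod (2 ^ 6)) hs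
  simp only [map_pow, map_add, map_mul, map_intCast] at h2
  push_cast at h2
  rcases hff with ⟨rfl, rfl⟩ | ⟨rfl, rfl⟩
  · push_cast at h2
    exact (key (PadicInt.toZModPow 6 t) (PadicInt.toZModPow 6 s)).1 (by linear_combination h2)
  · push_cast at h2
    exact (key (PadicInt.toZModPow 6 t) (PadicInt.toZModPow 6 s)).2 (by linear_combination h2)

end Summit.BirchSwinnertonDyer.BirchSwinnertonDyer.Theorems.GoldfeldGoodTwists

end
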